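import Summits.NavierStokesRegularity.NavierStokesRegularity.Theorems.TerminalTraceTypeITraceScarL3QuietShellTopMass
import Summits.NavierStokesRegularity.NavierStokesRegularity.Theorems.TerminalTraceTypeITraceScarL3QuietShellRepresentative
import HarnessLib

/-!
# STUB `stub_quietShell_noConcentration` (Q2+Q3+Q4, the Carleman half) of line `annulus-dichotomy`
# (skeleton v4, sha16 3f7a14107033987a) for item `TerminalTrace.TypeITraceScarL3`
# (stmt-NavierStokesRegularity-18385) — PROVED

Seat nsreg-C26-p1 (prover), `--supports stmt-NavierStokesRegularity-18385`; planner of record nsreg-p2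
g28 (ROUND-26 §1c «THE SQUEEZE»: (Q3) quiet-shell representative, (Q4) Tao (5.7)–(5.17), (Q2) the
contradiction with the zero top data).

The registered signature, VERBATIM: for every class `(M, D₀, C)` and constants `κ₀ > 0`,
`c₂ ∈ ]0, ½[` there is `A₀ > 1` such that an extinct Type-I apex of the class (suitable in every
`Q(a)`, weak gradient, `𝐈 ≤ M`, `D ≤ D₀` at apices `≤ 0`, rate `C/√(−s)`, weakly null at the top)
which is essentially bounded on a late quiet shell `]−δ, 0[ × {R < |y| < A₀ R}` can NOT have the
centre concentration at every depth with constants `(κ₀, c₂)`.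

Proof (assembly of tree theorems, no new analysis):
* `Literature.Analysis.FluidPDE.exists_classical_repr_of_apexPackage` — the continuous, jointly
  smooth representative `v` of `U` below the apex, classical on every `[b − T, b]`, `b < 0`;
  the concentration hypothesis, stated for ALL continuous `C¹`-sliced representatives, holds for `v`;
* `exists_quietShell_representative` (Q3') — on `]−δ/2, 0[ × {3R/2 < |y| < 3Λ_c R}` the field `U`
  has a continuous representative with `‖Dⁿ·‖ ≤ K'` (`n ≤ 4`) whose velocity, gradient and
  vorticity tend to `0` uniformly on compact sets as `t ↑ 0`; it coincides with `v` there
  (`Measure.eqOn_open_of_ae_eq`), so `v` inherits the bounds and the top vanishing;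
* `exists_annulus_vorticity_floor` (Q4, Tao (5.7)–(5.17)) — a `b`-independent floor `η > 0` for
  `∫_{4R ≤ |x| ≤ Λ_c R} |ω(b)|²` at every late `b`, contradicting the top vanishing.

WHAT THIS IS NOT: not the LOUD stub `stub_no_loudShellExtinctApex` (the open core), not item 18385,
no statement about Navier–Stokes regularity (which is NOT proved).
[cite: Tao2021, §5 (5.7)–(5.17); EscauriazaSereginSverak2003, §3–§5; AlbrittonBarker2019, Thm 1.1]
-/

noncomputable section

set_option linter.dupNamespace false

namespace Summit.NavierStokesRegularity.NavierStokesRegularity.Theorems.TypeITraceScarL3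

open MeasureTheory Set Function Filter Topology TopologicalSpace Metric InnerProductSpace
open Literature.Analysis Literature.Analysis.FluidPDE
open scoped NNReal ENNReal RealInnerProductSpace

/-- **STUB `stub_quietShell_noConcentration` (ROUND-26 Q2+Q3+Q4, skeleton v4 of line
`annulus-dichotomy`), registered signature verbatim** — an extinct Type-I apex with a late quiet shell
has no centre concentration at every depth: the quiet-shell representative, Tao's annulus floor and
the zero top data are incompatible. [cite: Tao2021, §5 (5.7)–(5.17); EscauriazaSereginSverak2003, §3–§5] -/
theorem stub_quietShell_noConcentration :
    ∀ (M D₀ : ℝ≥0) (C κ₀ c₂ : ℝ), 0 < κ₀ → 0 < c₂ → c₂ < 1 / 2 → ∃ A₀ : ℝ, 1 < A₀ ∧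
    ∀ (U : ℝ → EuclideanSpace ℝ (Fin 3) → EuclideanSpace ℝ (Fin 3))
      (P : ℝ → EuclideanSpace ℝ (Fin 3) → ℝ)
      (G : ℝ → EuclideanSpace ℝ (Fin 3) →
        EuclideanSpace ℝ (Fin 3) →L[ℝ] EuclideanSpace ℝ (Fin 3)),
      (∀ a : ℝ, 0 < a →
        IsSuitableWeakSolutionInBall a (0 : ℝ × EuclideanSpace ℝ (Fin 3)) U P) →
      (∀ a : ℝ, 0 < a →
        HasWeakSpatialGradientOn
          (parabolicCylinderOpens a (0 : ℝ × EuclideanSpace ℝ (Fin 3))) U G) →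
      (∀ a : ℝ, 0 < a →
        typeIBound (parabolicCylinder a (0 : ℝ × EuclideanSpace ℝ (Fin 3))) U P G ≤ M) →
      (∀ z₀ : ℝ × EuclideanSpace ℝ (Fin 3), z₀.1 ≤ 0 →
        ∀ r : ℝ, 0 < r → cknD r z₀ P ≤ D₀) →
      (∀ s : ℝ, s < 0 →
        ∀ᵐ y : EuclideanSpace ℝ (Fin 3), ‖U s y‖ ≤ C / Real.sqrt (-s)) →
      (∀ φ : EuclideanSpace ℝ (Fin 3) → EuclideanSpace ℝ (Fin 3),
        ContDiff ℝ (⊤ : ℕ∞) φ →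
        HasCompactSupport φ → ∀ ε : ℝ, 0 < ε →
        ∃ s₀ : ℝ, s₀ < 0 ∧ ∀ᵐ s ∂(volume.restrict (Ioo s₀ 0)), |∫ y, ⟪U s y, φ y⟫| ≤ ε) →
      (∃ δ : ℝ, 0 < δ ∧ ∃ R : ℝ, 0 < R ∧ ∃ K : ℝ,
        ∀ᵐ z ∂(volume.restrict
          (Ioo (-δ) 0 ×ˢ {y : EuclideanSpace ℝ (Fin 3) | R < ‖y‖ ∧ ‖y‖ < A₀ * R})),
            ‖U z.1 z.2‖ ≤ K) →
      ¬ (∀ T₁ : ℝ, 0 < T₁ → ∃ t₁ ∈ Icc (-T₁) (-T₁ / 2),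
        ∀ V : ℝ → EuclideanSpace ℝ (Fin 3) → EuclideanSpace ℝ (Fin 3),
          Function.uncurry V =ᵐ[volume.restrict
              (Ioo (-2 * T₁) (-T₁ / 4) ×ˢ (univ : Set (EuclideanSpace ℝ (Fin 3))))]
            Function.uncurry U →
          ContinuousOn (Function.uncurry V)
            (Ioo (-2 * T₁) (-T₁ / 4) ×ˢ (univ : Set (EuclideanSpace ℝ (Fin 3)))) →
          (∀ t ∈ Ioo (-2 * T₁) (-T₁ / 4), ContDiff ℝ 1 (V t)) →
          ∀ t ∈ Icc (t₁ - c₂ * T₁) t₁,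
            κ₀ * T₁ ^ (-(1 / 2 : ℝ)) ≤
              ∫ x in ball (0 : EuclideanSpace ℝ (Fin 3)) (Real.sqrt T₁), ‖curl (V t) x‖ ^ 2) := by
  intro M D₀ C κ₀ c₂ hκ₀ hc₂ hc₂'
  obtain ⟨Λc, hΛc, hfloor⟩ := exists_annulus_vorticity_floor C D₀ hκ₀ hc₂ hc₂'
  refine ⟨4 * Λc, by linarith only [hΛc], ?_⟩
  intro U P G hsw _hG hI hD hrate htop hq hQ1
  obtain ⟨δ, hδ, R, hR, Kq, hquiet⟩ := hq
  have hΛc0 : 0 < Λc := by linarith only [hΛc]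
  have hΛR : 0 < Λc * R := mul_pos hΛc0 hR
  -- ### the classical representative below the apex, and (Q1) for it
  obtain ⟨v, hvU, hvc, -, hvs, -, -, -, hcl⟩ :=
    exists_classical_repr_of_apexPackage (M := M) (C := C) hsw hI hrate
  have hvslice : ∀ t < 0, ContDiff ℝ (⊤ : ℕ∞) (v t) := fun t ht =>
    hvs.contDiff_slice (show t ∈ Iio (0 : ℝ) from ht)
  have hQ1v : ∀ T₁ : ℝ, 0 < T₁ → ∃ t₁ ∈ Icc (-T₁) (-T₁ / 2), ∀ t ∈ Icc (t₁ - c₂ * T₁) t₁,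
      κ₀ * T₁ ^ (-(1 / 2 : ℝ)) ≤
        ∫ x in ball (0 : EuclideanSpace ℝ (Fin 3)) (Real.sqrt T₁), ‖curl (v t) x‖ ^ 2 := by
    intro T₁ hT₁
    obtain ⟨t₁, ht₁, h⟩ := hQ1 T₁ hT₁
    have hsub : Ioo (-2 * T₁) (-T₁ / 4) ×ˢ (univ : Set (EuclideanSpace ℝ (Fin 3))) ⊆ Iio 0 ×ˢ univ :=
      prod_mono (fun t ht => lt_of_lt_of_le ht.2 (by linarith only [hT₁])) subset_rfl
    refine ⟨t₁, ht₁, h v ?_ (hvc.mono hsub) fun t ht => ?_⟩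
    · exact (ae_restrict_of_ae_restrict_of_subset hsub hvU).mono fun w hw => hw.symm
    · exact (hvslice t (lt_of_lt_of_le ht.2 (by linarith only [hT₁]))).of_le
        (by exact_mod_cast le_top)
  -- ### the quiet-shell representative (Q3')
  set δ' : ℝ := δ / 2 with hδ'def
  have hδ'0 : 0 < δ' := by positivity
  have hδ'δ : δ' < δ := by rw [hδ'def]; linarith only [hδ]
  set R₁ : ℝ := 3 / 2 * R with hR₁def
  set R₂ : ℝ := 3 * Λc * R with hR₂def
  have hR₁ : R < R₁ := by rw [hR₁def]; linarith only [hR]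
  have hR₂ : R₂ < 4 * Λc * R := by rw [hR₂def]; linarith only [hΛR]
  obtain ⟨K', V₃, hV₃U, hV₃c, -, -, hV₃K, -, -, -, -, -, htv⟩ :=
    exists_quietShell_representative hsw hD htop hquiet hδ'0 hδ'δ hR₁ hR₂
  set S' : Set (EuclideanSpace ℝ (Fin 3)) := {y | R₁ < ‖y‖ ∧ ‖y‖ < R₂} with hS'def
  have hS'o : IsOpen S' :=
    (isOpen_lt continuous_const continuous_norm).inter (isOpen_lt continuous_norm continuous_const)
  set Ω : Set (ℝ × EuclideanSpace ℝ (Fin 3)) := Ioo (-δ') 0 ×ˢ S' with hΩdef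
  have hΩo : IsOpen Ω := isOpen_Ioo.prod hS'o
  have hΩsub : Ω ⊆ Iio 0 ×ˢ univ := prod_mono (fun t ht => ht.2) (subset_univ _)
  -- `V₃ = v` on `Ω`: both are continuous representatives of `U`
  have hae : uncurry V₃ =ᵐ[volume.restrict Ω] uncurry v :=
    hV₃U.trans (ae_restrict_of_ae_restrict_of_subset hΩsub hvU)
  have hEq : EqOn (uncurry V₃) (uncurry v) Ω :=
    Measure.eqOn_open_of_ae_eq hae hΩo hV₃c (hvc.mono hΩsub)
  have hsl : ∀ t ∈ Ioo (-δ') 0, ∀ x ∈ S', v t =ᶠ[𝓝 x] V₃ t := fun t ht x hx =>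
    Filter.eventually_of_mem (hS'o.mem_nhds hx) fun y hy => (hEq (mk_mem_prod ht hy)).symm
  -- norms of first and second derivatives as iterated derivatives
  have hn1 : ∀ (f : EuclideanSpace ℝ (Fin 3) → EuclideanSpace ℝ (Fin 3)) (x : EuclideanSpace ℝ (Fin 3)),
      ‖fderiv ℝ f x‖ = ‖iteratedFDeriv ℝ 1 f x‖ := by
    intro f x
    have e := norm_iteratedFDeriv_fderiv (𝕜 := ℝ) (f := f) (x := x) (n := 0)
    rw [norm_iteratedFDeriv_zero, zero_add] at e
    exact e
  have hn2 : ∀ (f : EuclideanSpace ℝ (Fin 3) → EuclideanSpace ℝ (Fin 3)) (x : EuclideanSpace ℝ (Fin 3)),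
      ‖fderiv ℝ (fderiv ℝ f) x‖ = ‖iteratedFDeriv ℝ 2 f x‖ := by
    intro f x
    have e₁ := norm_iteratedFDeriv_fderiv (𝕜 := ℝ) (f := fderiv ℝ f) (x := x) (n := 0)
    rw [norm_iteratedFDeriv_zero, zero_add] at e₁
    rw [e₁]
    exact norm_iteratedFDeriv_fderiv
  have hvd2 : ∀ t < 0, ∀ x : EuclideanSpace ℝ (Fin 3), DifferentiableAt ℝ (fderiv ℝ (v t)) x :=
    fun t ht x => by
      have h2 : ContDiff ℝ 2 (v t) := contDiff_infty.1 (hvslice t ht) 2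
      exact ((h2.fderiv_right (m := 1) one_add_one_eq_two.le).differentiable
        one_ne_zero).differentiableAt
  -- ### the bounds for `v` on the quiet shell slab
  set K₃ : ℝ := max 1 (max K' (‖curlCLM‖ * K')) with hK₃def
  have hK₃1 : 1 ≤ K₃ := le_max_left _ _
  have hK'K₃ : K' ≤ K₃ := (le_max_left _ _).trans (le_max_right _ _)
  have hcK₃ : ‖curlCLM‖ * K' ≤ K₃ := (le_max_right _ _).trans (le_max_right _ _)
  have hK3v : ∀ t ∈ Ioo (-δ') 0, ∀ x : EuclideanSpace ℝ (Fin 3), R₁ < ‖x‖ → ‖x‖ < R₂ →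
      ‖v t x‖ ≤ K₃ ∧ ‖fderiv ℝ (v t) x‖ ≤ K₃ ∧ ‖vorticity v t x‖ ≤ K₃ ∧
        ‖fderiv ℝ (vorticity v t) x‖ ≤ K₃ := by
    intro t ht x hx1 hx2
    have hx : x ∈ S' := ⟨hx1, hx2⟩
    have hz : (t, x) ∈ Ω := mk_mem_prod ht hx
    have he := hsl t ht x hx
    have h0 : ‖v t x‖ ≤ K' := by
      have h := hV₃K 0 (by norm_num) (t, x) hz
      rw [norm_iteratedFDeriv_zero] at h
      rw [he.eq_of_nhds]
      exact h
    have h1 : ‖fderiv ℝ (v t) x‖ ≤ K' := by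
      have h := hV₃K 1 (by norm_num) (t, x) hz
      rw [he.fderiv_eq, hn1]
      exact h
    have h2 : ‖fderiv ℝ (fderiv ℝ (v t)) x‖ ≤ K' := by
      have h := hV₃K 2 (by norm_num) (t, x) hz
      rw [hn2, (he.iteratedFDeriv ℝ 2).eq_of_nhds]
      exact h
    have hω : ‖vorticity v t x‖ ≤ ‖curlCLM‖ * K' := by
      rw [vorticity_apply, curl_eq_curlCLM]
      exact (curlCLM.le_opNorm _).trans (mul_le_mul_of_nonneg_left h1 (norm_nonneg _))
    have hDω : ‖fderiv ℝ (vorticity v t) x‖ ≤ ‖curlCLM‖ * K' := by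
      rw [vorticity_apply, curl_eq_curlCLM_comp,
        (curlCLM.hasFDerivAt.comp x (hvd2 t ht.2 x).hasFDerivAt).fderiv]
      exact (curlCLM.opNorm_comp_le _).trans (mul_le_mul_of_nonneg_left h2 (norm_nonneg _))
    exact ⟨h0.trans hK'K₃, h1.trans hK'K₃, hω.trans hcK₃, hDω.trans hcK₃⟩
  -- ### (Q4) the annulus floor at every late time
  have hR' : (0 : ℝ) < 2 * R := by positivity
  have hR₁R' : R₁ < 2 * R := by rw [hR₁def]; linarith only [hR]
  have hΛR' : Λc * (2 * R) < R₂ := by rw [hR₂def]; linarith only [hΛR]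
  obtain ⟨η, b₀, hη, hb₀, hfl⟩ := hfloor U P v hsw hD hrate hvU hvc hvs hcl hQ1v Λc (2 * R) δ' R₁ R₂
    K₃ le_rfl hR' hδ'0 hK₃1 hR₁R' hΛR' hK3v
  -- ### the annulus `{4R ≤ |x| ≤ Λc R}` and the zero top data on it
  set Cset : Set (EuclideanSpace ℝ (Fin 3)) :=
    closedBall (0 : EuclideanSpace ℝ (Fin 3)) (Λc * (2 * R) / 2) \ ball 0 (2 * (2 * R)) with hCdef
  have hCc : IsCompact Cset := (isCompact_closedBall _ _).diff isOpen_ball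
  have hCS' : Cset ⊆ S' := by
    intro x hx
    rw [hCdef] at hx
    have h1 : ‖x‖ ≤ Λc * (2 * R) / 2 := mem_closedBall_zero_iff.1 hx.1
    have h2 : ¬ ‖x‖ < 2 * (2 * R) := fun h => hx.2 (mem_ball_zero_iff.2 h)
    rw [hS'def]
    refine ⟨?_, ?_⟩
    · show R₁ < ‖x‖
      rw [hR₁def]; linarith only [hR, not_lt.1 h2]
    · show ‖x‖ < R₂
      rw [hR₂def]; linarith only [h1, hΛR]
  have hCvol : volume Cset < ⊤ :=
    (measure_mono fun x hx => hx.1).trans_lt measure_closedBall_lt_top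
  set m : ℝ := volume.real Cset with hmdef
  have hm0 : 0 ≤ m := measureReal_nonneg
  set A : ℝ := (‖curlCLM‖ ^ 2 + 1) * (m + 1) with hAdef
  have hA0 : 0 < A := by positivity
  set θ : ℝ := min 1 (η / (2 * A)) with hθdef
  have hθ0 : 0 < θ := lt_min one_pos (by positivity)
  have hθ1 : θ ≤ 1 := min_le_left _ _
  have hθA : θ ≤ η / (2 * A) := min_le_right _ _
  obtain ⟨s₀, hs₀0, hs₀δ, hsmall⟩ := htv θ hθ0 Cset hCc hCS'
  -- ### the late time `b`
  set b : ℝ := max s₀ b₀ / 2 with hbdef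
  have hbmax : max s₀ b₀ < 0 := max_lt hs₀0 hb₀
  have hb0 : b < 0 := by rw [hbdef]; linarith only [hbmax]
  have hbs₀ : s₀ < b := by rw [hbdef]; linarith only [le_max_left s₀ b₀, hbmax]
  have hbb₀ : b₀ < b := by rw [hbdef]; linarith only [le_max_right s₀ b₀, hbmax]
  have hbI : b ∈ Ioo (-δ') 0 := ⟨by linarith only [hs₀δ, hbs₀], hb0⟩
  -- the annulus enstrophy at time `b` is below the floor
  have hsmallint : ∫ x in Cset, ‖vorticity v b x‖ ^ 2 ≤ (‖curlCLM‖ * θ) ^ 2 * m := by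
    have h1 := norm_setIntegral_le_of_norm_le_const (μ := volume)
      (f := fun x => ‖vorticity v b x‖ ^ 2) (C := (‖curlCLM‖ * θ) ^ 2) hCvol fun x hx => by
        rw [Real.norm_of_nonneg (sq_nonneg _)]
        have he := hsl b hbI x (hCS' hx)
        have hωeq : vorticity v b x = vorticity V₃ b x := by
          rw [vorticity_apply, vorticity_apply, curl_eq_curlCLM, curl_eq_curlCLM, he.fderiv_eq]
        rw [hωeq]
        exact pow_le_pow_left₀ (norm_nonneg _) (hsmall b ⟨hbs₀, hb0⟩ x hx).2.2 2
    exact (Real.le_norm_self _).trans h1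
  have hlt : (‖curlCLM‖ * θ) ^ 2 * m < η := by
    have hθsq : θ ^ 2 ≤ θ := pow_le_of_le_one hθ0.le hθ1 two_ne_zero
    have hcm : ‖curlCLM‖ ^ 2 * m ≤ A := by
      rw [hAdef]
      exact mul_le_mul (by linarith only [sq_nonneg ‖curlCLM‖]) (by linarith only [hm0]) hm0
        (by positivity)
    have hAη : A * (η / (2 * A)) = η / 2 := by
      field_simp
    calc (‖curlCLM‖ * θ) ^ 2 * m = ‖curlCLM‖ ^ 2 * m * θ ^ 2 := by ring
      _ ≤ ‖curlCLM‖ ^ 2 * m * θ := mul_le_mul_of_nonneg_left hθsq (by positivity)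
      _ ≤ A * θ := mul_le_mul_of_nonneg_right hcm hθ0.le
      _ ≤ A * (η / (2 * A)) := mul_le_mul_of_nonneg_left hθA hA0.le
      _ = η / 2 := hAη
      _ < η := by linarith only [hη]
  exact absurd ((hfl b ⟨hbb₀, hb0⟩).trans hsmallint) (not_le.2 hlt)

end Summit.NavierStokesRegularity.NavierStokesRegularity.Theorems.TypeITraceScarL3
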